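import Mathlib
import HarnessLib
import Summits.QuantumFields.YangMills.Theses.PencilRigidity
import Summits.QuantumFields.YangMills.Theorems.PencilRigidityCurvatureKernelBoundAxisEnvelope
import Summits.QuantumFields.YangMills.Theorems.PencilRigidityCurvatureKernelBoundKernelPinning
import Summits.QuantumFields.YangMills.Theorems.PencilRigidityCurvatureKernelBoundPartitionBump
import Summits.QuantumFields.YangMills.Theorems.PencilRigidityCurvatureKernelBoundLocalRepresentation
import Summits.QuantumFields.YangMills.Theorems.PencilRigidityCurvatureKernelBoundKernelExistence
import Summits.QuantumFields.YangMills.Theorems.PencilRigidityCurvatureKernelBoundTwoPointLocalBoundScaling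
import Summits.QuantumFields.YangMills.Theorems.PencilRigidityCurvatureKernelBoundHalfSpaceKernel
import Summits.QuantumFields.YangMills.Theorems.PencilRigidityCurvatureKernelBoundLatticeWindowPairOfOne
import Summits.QuantumFields.YangMills.Theorems.PencilRigidityCurvatureKernelBoundLatticeWindowTransfer

/-!
# `CurvatureKernelBound` — the kernel conclusion for ONE witness from its lattice window bound, D-FREE (support for stmt-QuantumFields-11687)

Crux `stmt-QuantumFields-11687` (`PencilRigidity.CurvatureKernelBound`), line `sixteen-charts-analytic-kernel`, skeleton v12 —
the EXISTENCE-LEG form of the D-free reduction (registered sub-goal `KernelConclusionOfWitnessLatticeDFree`). For ONE datum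
`(G, r, sch, S₁)` carrying the curvature package `W₁`, the ONE-VARIABLE LATTICE WINDOW BOUND of the scheme ALONE — frequently in `k`,
`c_k² |Cov_k(Q_0, Q_z)| ≤ C (a_k‖z‖)^(η−10)` for `z ≠ 0` in the box with `R₀ ≤ ‖z‖`, `a_k‖z‖ ≤ θ` — gives the conclusion of the crux
for `S₁`: a real kernel continuous off `0`, `|K x| ≤ C (1 + ‖x‖^(η−10))`, representing `S₁ 2` on `⁰𝒮`. Compared with the landed
`KernelConclusionOfWitnessLattice` (v10) the diagonal-frame reflection positivity hypothesis (the witness's share of `DiagonalMirrorRPR`,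
route item stmt-QuantumFields-10604) is GONE: the representing kernel now comes from the lattice local bound
(`TwoPointLocalBoundScaling` fed with the pair window bound `LatticeWindowPairOfOne`), the half-space kernel of the OS Hilbert space
(`HalfSpaceKernel PartitionBump`), `LocalRepresentation` and `KernelExistence`; the UV datum from `LatticeWindowTransfer`; reality from
`LatticeReality`; the envelope from `AxisEnvelope` — exactly the proof of `CurvatureKernelBoundReductionDFree`, run for one witness.
This is the statement a planner folds into the existence leg (`HypercubicLimit` witness + its lattice UV window bound ⇒ everything the
route's `closes` takes from `CurvatureKernelBound` for that witness). [folklore]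
-/

noncomputable section

open scoped BigOperators Topology
open MeasureTheory Filter Set
open Literature.MathematicalPhysics.QuantumLattice Literature.MathematicalPhysics.AQFT
open Literature.MathematicalPhysics.QuantumFieldTheory

namespace Summit.QuantumFields.YangMills.Theorems.CurvatureKernel

/-- **`KernelConclusionOfWitnessLatticeDFree`** (registered sub-goal of stmt-QuantumFields-11687). For one datum `(G, r, sch, S₁)` with
the curvature package `W₁` and the one-variable lattice window bound of `(r, sch)`, the conclusion of `CurvatureKernelBound` holds for
`S₁` — with NO diagonal-mirror hypothesis. [folklore] -/
theorem KernelConclusionOfWitnessLatticeDFree : open Literature.MathematicalPhysics.QuantumLattice Literature.MathematicalPhysics.AQFT Literature.MathematicalPhysics.QuantumFieldTheory in ∀ (G : Type) [Group G] [TopologicalSpace G] [IsTopologicalGroup G] [CompactSpace G] [MeasurableSpace G] [BorelSpace G], IsCompactSimpleLieGroup G → ∀ (r : LatticeRep G) (sch : SpeciesScheme (YMSpecies G)) (S₁ : SchwingerFamily (EuclideanSpace ℝ (Fin 4))), ((∀ (n : ℕ), n ≠ 0 → ∀ (f : Fin n → SchwartzMap (EuclideanSpace ℝ (Fin 4)) ℝ)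 (F : SchwartzMap (Fin n → (EuclideanSpace ℝ (Fin 4))) ℂ), IsTensorOf F (fun i => ofRealTest (f i)) → IsOffDiagonal F → Filter.Tendsto (fun k : ℕ => ((latticeSchwinger r.ρ sch (fun s => s.F) k n (fun _ => r.curvature) f : ℝ) : ℂ)) Filter.atTop (nhds (S₁ n F))) ∧ (S₁.toLabelled.IsNormalized ∧ S₁.toLabelled.IsHermitian ∧ S₁.toLabelled.HasLinearGrowth ∧ S₁.toLabelled.IsReflectionPositive ∧ S₁.toLabelled.IsSymmetric ∧ S₁.toLabelled.HasClusterProperty) ∧ (∀ (n : ℕ) (a : (EuclideanSpace ℝ (Fin 4))) (F : SchwartzMap (Fin n → (EuclideanSpace ℝ (Fin 4))) ℂ), IsOffDiagonal F → S₁ n (translateMulti a F) = S₁ n F) ∧ (∀ (R : (EuclideanSpace ℝ (Fin 4)) ≃ₗᵢ[ℝ] (EuclideanSpace ℝ (Fin 4))), LinearMap.det (R.toLinearEquiv : (EuclideanSpace ℝ (Fin 4)) →ₗ[ℝ] (EuclideanSpace ℝ (Fin 4))) = 1 → (∀ i : Fin 4, ∃ j : Fin 4, R (EuclideanSpace.single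 i 1) = EuclideanSpace.single j 1 ∨ R (EuclideanSpace.single i 1) = -EuclideanSpace.single j 1) → ∀ (n : ℕ) (F : SchwartzMap (Fin n → (EuclideanSpace ℝ (Fin 4))) ℂ), IsOffDiagonal F → S₁ n (linActMulti R F) = S₁ n F) ∧ (∃ Δ : ℝ, 0 < Δ ∧ S₁.toLabelled.HasMassGap Δ ∧ HasLatticeMassGap r sch Δ)) → (∃ (C η θ R₀ : ℝ), 0 < η ∧ 0 < θ ∧ ∃ᶠ k in Filter.atTop, ∀ z : Literature.Probability.LatticeModels.Site 4, z ∈ Literature.Probability.LatticeModels.box 4 (sch.L k) → z ≠ 0 → R₀ ≤ ‖siteToE z‖ → sch.a k * ‖siteToE z‖ ≤ θ → (sch.c r.curvature k) ^ 2 * |(∫ U, r.curvature.F (torusLift (sch.side k) U) * r.curvature.F (configShift (-z) (torusLift (sch.side k) U)) ∂(wilsonMeasure r.ρ (sch.β k) : MeasureTheory.Measure (GaugeConfig 4 (sch.side k) G))) - (∫ U, r.curvature.F (torusLift (sch.side k) U) ∂(wilsonMeasure r.ρ (sch.β k) : MeasureTheory.Measure (GaugeConfig 4 (sch.side k) G)))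 * (∫ U, r.curvature.F (configShift (-z) (torusLift (sch.side k) U)) ∂(wilsonMeasure r.ρ (sch.β k) : MeasureTheory.Measure (GaugeConfig 4 (sch.side k) G)))| ≤ C * (sch.a k * ‖siteToE z‖) ^ (η - 10)) → ∃ (K : (EuclideanSpace ℝ (Fin 4)) → ℝ) (C η : ℝ), 0 < η ∧ ContinuousOn K {x : (EuclideanSpace ℝ (Fin 4)) | x ≠ 0} ∧ (∀ x : (EuclideanSpace ℝ (Fin 4)), x ≠ 0 → |K x| ≤ C * (1 + ‖x‖ ^ (η - 10))) ∧ ∀ F : SchwartzMap (Fin 2 → (EuclideanSpace ℝ (Fin 4))) ℂ, IsOffDiagonal F → MeasureTheory.Integrable (fun x : Fin 2 → (EuclideanSpace ℝ (Fin 4)) => (K (x 0 - x 1) : ℂ) * F x) ∧ S₁ 2 F = ∫ x : Fin 2 → (EuclideanSpace ℝ (Fin 4)), (K (x 0 - x 1) : ℂ) * F x := by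
  intro G _ _ _ _ _ _ hG r sch S₁ hW₁ hwin
  obtain ⟨hconv, hpkg, htr, hhyp, hgap⟩ := hW₁
  -- the pair window bound of this witness (torus translation invariance)
  have hpair := LatticeWindowPairOfOne G r sch hwin
  -- (A) the complex kernel, continuous off 0, representing S₁ 2 on ⁰𝒮 — D-FREE: lattice local bound + half-space kernel
  obtain ⟨K, hcont, hrep⟩ := KernelExistence (HalfSpaceKernel PartitionBump) LocalRepresentation S₁ hpkg.2.2.2.1 htr hhyp
    (TwoPointLocalBoundScaling G hG r sch S₁ ⟨hconv, hpkg, htr, hhyp, hgap⟩ hpair)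
  -- reality of S₁ 2 on real off-diagonal tensors: a limit of real lattice correlations
  have hrealS : ∀ (f : Fin 2 → SchwartzMap (EuclideanSpace ℝ (Fin 4)) ℝ)
      (F : SchwartzMap (Fin 2 → EuclideanSpace ℝ (Fin 4)) ℂ),
      IsTensorOf F (fun i => ofRealTest (f i)) → IsOffDiagonal F → (S₁ 2 F).im = 0 := by
    intro f F hF hoff
    have ht := hconv 2 (by norm_num) f F hF hoff
    have hc := (Complex.continuous_im.tendsto _).comp ht
    have h0 : Filter.Tendsto (fun _ : ℕ => (0 : ℝ)) Filter.atTop (nhds (S₁ 2 F).im) :=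
      hc.congr (fun k => by simp)
    exact (tendsto_const_nhds_iff.mp h0).symm
  -- (C) the kernel is real off 0
  have him : ∀ x, x ≠ 0 → (K x).im = 0 := LatticeReality S₁ K hcont hrep hrealS
  -- (B) the axial envelope (axis reflection positivity only)
  obtain ⟨hpos, hmono, henv⟩ := AxisEnvelope S₁ K hpkg.2.2.2.1 htr hhyp hcont hrep
  -- (E) the UV datum: growth of k(s) = K(s e₀) on (0, 1], transferred from the lattice window bound
  obtain ⟨C, η, hη, hax⟩ := LatticeWindowTransfer G hG r sch S₁ ⟨hconv, hpkg, htr, hhyp, hgap⟩ hpair K hcont hrep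
  -- constants
  set k₀ : ℝ := (K (EuclideanSpace.single 0 (1 / 2 : ℝ))).re with hk₀
  have hk₀nn : 0 ≤ k₀ := (hpos (1 / 2) (by norm_num)).2
  have h2pos : (0 : ℝ) < 2 ^ (η - 10) := Real.rpow_pos_of_pos (by norm_num) _
  set C₁ : ℝ := |C| / 2 ^ (η - 10) with hC₁
  have hC₁nn : 0 ≤ C₁ := div_nonneg (abs_nonneg C) h2pos.le
  refine ⟨fun x => (K x).re, k₀ + C₁, η, hη, ?_, ?_, ?_⟩
  · -- continuity off 0
    exact Complex.continuous_re.comp_continuousOn hcont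
  · -- the bound |K_real x| ≤ (k₀ + C₁) (1 + ‖x‖^(η-10))
    intro x hx
    have htpos : 0 < ‖x‖ := norm_pos_iff.mpr hx
    have hrnn : 0 ≤ ‖x‖ ^ (η - 10) := Real.rpow_nonneg htpos.le _
    have h1 : |(K x).re| ≤ (K (EuclideanSpace.single 0 (‖x‖ / 2))).re :=
      (Complex.abs_re_le_norm _).trans (henv x hx)
    by_cases hle : ‖x‖ ≤ 1
    · have h2 : (K (EuclideanSpace.single 0 (‖x‖ / 2))).re ≤ C * (‖x‖ / 2) ^ (η - 10) :=
        (Complex.re_le_norm _).trans (hax (‖x‖ / 2) (half_pos htpos) (by linarith))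
      have h3 : C * (‖x‖ / 2) ^ (η - 10) ≤ C₁ * ‖x‖ ^ (η - 10) := by
        rw [Real.div_rpow htpos.le zero_le_two, hC₁]
        calc C * (‖x‖ ^ (η - 10) / 2 ^ (η - 10))
            ≤ |C| * (‖x‖ ^ (η - 10) / 2 ^ (η - 10)) :=
              mul_le_mul_of_nonneg_right (le_abs_self C) (div_nonneg hrnn h2pos.le)
          _ = |C| / 2 ^ (η - 10) * ‖x‖ ^ (η - 10) := by ring
      calc |(K x).re| ≤ C₁ * ‖x‖ ^ (η - 10) := h1.trans (h2.trans h3)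
        _ ≤ (k₀ + C₁) * ‖x‖ ^ (η - 10) := by nlinarith [hk₀nn, hrnn]
        _ ≤ (k₀ + C₁) * (1 + ‖x‖ ^ (η - 10)) := by nlinarith [hk₀nn, hC₁nn, hrnn]
    · have hlt : 1 < ‖x‖ := lt_of_not_ge hle
      have h2 : (K (EuclideanSpace.single 0 (‖x‖ / 2))).re ≤ k₀ :=
        hmono (Set.mem_Ioi.mpr (by norm_num : (0 : ℝ) < 1 / 2)) (Set.mem_Ioi.mpr (half_pos htpos))
          (by linarith)
      calc |(K x).re| ≤ k₀ := h1.trans h2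
        _ ≤ (k₀ + C₁) * 1 := by linarith [hC₁nn]
        _ ≤ (k₀ + C₁) * (1 + ‖x‖ ^ (η - 10)) := by nlinarith [hk₀nn, hC₁nn, hrnn]
  · -- the representation on ⁰𝒮 with the real kernel: the integrands coincide pointwise
    intro F hF
    have hfun : (fun y : Fin 2 → EuclideanSpace ℝ (Fin 4) => (((K (y 0 - y 1)).re : ℝ) : ℂ) * F y) =
        fun y => K (y 0 - y 1) * F y := by
      funext y
      by_cases h : y 0 = y 1
      · have hy : y ∈ coincidenceLocus 2 (EuclideanSpace ℝ (Fin 4)) :=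
          (mem_coincidenceLocus y).mpr ⟨0, 1, by decide, h⟩
        simp [hF.apply_eq_zero hy]
      · have hne : y 0 - y 1 ≠ 0 := sub_ne_zero.mpr h
        congr 1
        exact Complex.ext (by simp) (by simp [him _ hne])
    obtain ⟨hint, hSF⟩ := hrep F hF
    refine ⟨?_, ?_⟩
    · rw [hfun]; exact hint
    · rw [hfun]; exact hSF

end Summit.QuantumFields.YangMills.Theorems.CurvatureKernel

end
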